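import Summits.PneNP.PneNP.Theses.OneSlice
import Literature.Computability.Complexity.Rossman2008
import Literature.Computability.Complexity.Rossman2008CliqueProofs
import Literature.Computability.Complexity.CliqueTestGraphs

/-!
# `SliceACZero` (stmt-PneNP-2835, route PneNP/OneSlice) — negative-side lemmas I: load-bearing clauses of
# the conclusion

Standing-adversary (cdisprove) output for the crux
`Summit.PneNP.PneNP.Theses.OneSlice.SliceACZero` (descent of the average-case AC⁰ lower bound for
k-CLIQUE from `G(n,q)` to every central slice `G(n,j)`), an implication `Hyp → Conc` with
`Hyp = ∀ d c, ∃ k ≥ 3, ∃ δ > 0, InnerHyp d c k δ` (fixed-δ, window-uniform single-threshold AC⁰ bound on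
`G(n,q)`, Rossman 2008 strength) and `Conc = ∀ d c, ∃ k ≥ 3, ∃ δ > 0, InnerConc d c k δ` (the same on
every central slice). The crux is NOT refuted and NOT mis-stated; this file records, as theorems, which
of its clauses any proof must use.

* §0 `sliceACZero_iff` — read-back: the crux restated with `gnpDisagreeProb`/`cliqueFn`/`edgeCount`
  (definitional).
* §1 witnesses: `x_e` (size 0, depth 0), one gate with an arbitrary truth table
  (`exists_oneGate_circuit`), the constant gate `∧₀`.
* §2 LOAD-BEARING clauses of the conclusion — each dropped clause makes the inner clause false for ALL
  admissible parameters (so the crux with that clause dropped from its conclusion is equivalent to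
  `¬Hyp`, i.e. provable only vacuously): `not_innerConcNoWindow` (slice `j = 0`),
  `not_innerConcWindowAbove` (slice `j = C(n,2)`), `not_innerConcNoBasis` (one CLIQUE gate),
  `not_innerConcNoError`.
* Companions in this directory: `LoadBearingHyp.lean` (the same clauses on the hypothesis side; global
  corollaries), `QuantifierOrder.lean` (for depth `d ≥ 2` and `k ≤ c` the genuine inner clauses fail
  for every `δ ≥ 0`: every witness has `c < k`), `DeltaBeforeK.lean` (for `d ≥ 1` and `δ ≥ 1/k!` they
  fail: every witness has `δ < 1/k!`; first moment on the slice), `WindowDepth.lean` (the lower window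
  edge cannot be moved to `m · n^{-ε}`).

Refuter seat cdisprove-stmt-PneNP-2835 (gen 1), 2026-08-16. In the docstrings, `InnerConc d c k δ` /
`InnerHyp d c k δ` (and their `NoWindow`/`NoBasis`/… variants) denote the displayed inner clauses; they are
named predicates only in the work file `Summits/PneNP/PneNP/Cruxes/SliceACZero/Disproof.lean` (running
commentary: why the crux resists, what was not attempted) and are INLINED here.
-/

noncomputable section

namespace Summit.PneNP.PneNP.Theorems.SliceACZero.Negative

open Literature.Computability.Complexity Filter Finset
open Summit.PneNP.PneNP.Theses.OneSlice (SliceACZero)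


/-! ### Vocabulary: threshold, slice error, the inner clauses of the crux -/

/-- `m_k(n) = ⌊C(n,2) · n^{-2/(k-1)}⌋₊`, the critical edge count (E[#K_k] → 1/k!). [folklore] -/
def mk (n k : ℕ) : ℕ := ⌊((n.choose 2 : ℕ) : ℝ) * (n : ℝ) ^ (-(2 : ℝ) / ((k : ℝ) - 1))⌋₊

/-- Number of edge vectors with exactly `j` edges (the size of the slice `G(n,j)`). [folklore] -/
def sliceCard (n j : ℕ) : ℕ :=
  #(univ.filter fun x : (⊤ : SimpleGraph (Fin n)).edgeSet → Bool => edgeCount x = j)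

/-- Number of edge vectors with exactly `j` edges on which `f` and `g` disagree. [folklore] -/
def sliceErr (n j : ℕ) (f g : ((⊤ : SimpleGraph (Fin n)).edgeSet → Bool) → Bool) : ℕ :=
  #(univ.filter fun x : (⊤ : SimpleGraph (Fin n)).edgeSet → Bool => edgeCount x = j ∧ f x ≠ g x)

/-- **Read-back.** The crux is literally
`(∀ d c, ∃ k ≥ 3, ∃ δ > 0, (∀ᶠ n : ℕ in atTop, ∀ q : ℝ, 0 ≤ q → q ≤ 1 →
        |q * (n.choose 2 : ℕ) - (mk n k : ℝ)| ≤ (mk n k : ℝ) ^ ((3 : ℝ) / 4) →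
        ∀ C : Circuit ((⊤ : SimpleGraph (Fin n)).edgeSet), C.IsOver acBasis → C.acDepth ≤ d →
          gnpDisagreeProb n q C.eval (cliqueFn n k) ≤ δ → n ^ c < C.size)) → (∀ d c, ∃ k ≥ 3, ∃ δ > 0, (∀ᶠ n : ℕ in atTop, ∀ j : ℕ, |(j : ℝ) - (mk n k : ℝ)| ≤ (mk n k : ℝ) ^ ((3 : ℝ) / 4) →
        ∀ C : Circuit ((⊤ : SimpleGraph (Fin n)).edgeSet), C.IsOver acBasis → C.acDepth ≤ d →
          (sliceErr n j C.eval (cliqueFn n k) : ℝ) ≤ δ * sliceCard n j → n ^ c < C.size))`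
(definitional unfolding of the route decl). [folklore] -/
theorem sliceACZero_iff : SliceACZero ↔
    ((∀ d c : ℕ, ∃ k : ℕ, 3 ≤ k ∧ ∃ δ : ℝ, 0 < δ ∧ (∀ᶠ n : ℕ in atTop, ∀ q : ℝ, 0 ≤ q → q ≤ 1 →
        |q * (n.choose 2 : ℕ) - (mk n k : ℝ)| ≤ (mk n k : ℝ) ^ ((3 : ℝ) / 4) →
        ∀ C : Circuit ((⊤ : SimpleGraph (Fin n)).edgeSet), C.IsOver acBasis → C.acDepth ≤ d →
          gnpDisagreeProb n q C.eval (cliqueFn n k) ≤ δ → n ^ c < C.size)) →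
      ∀ d c : ℕ, ∃ k : ℕ, 3 ≤ k ∧ ∃ δ : ℝ, 0 < δ ∧ (∀ᶠ n : ℕ in atTop, ∀ j : ℕ, |(j : ℝ) - (mk n k : ℝ)| ≤ (mk n k : ℝ) ^ ((3 : ℝ) / 4) →
        ∀ C : Circuit ((⊤ : SimpleGraph (Fin n)).edgeSet), C.IsOver acBasis → C.acDepth ≤ d →
          (sliceErr n j C.eval (cliqueFn n k) : ℝ) ≤ δ * sliceCard n j → n ^ c < C.size)) :=
  Iff.rfl

/-! ### Small circuits used as witnesses -/

/-- The all-false vector is the only edge vector with no edge switched on. [folklore] -/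
theorem eq_false_of_edgeCount_eq_zero {n : ℕ} {x : (⊤ : SimpleGraph (Fin n)).edgeSet → Bool}
    (h : edgeCount x = 0) : x = fun _ => false := by
  funext e
  rw [edgeCount, Finset.card_eq_zero, Finset.filter_eq_empty_iff] at h
  simpa using h (mem_univ e)

/-- The all-true vector is the only edge vector with all `C(n,2)` edges switched on. [folklore] -/
theorem eq_true_of_edgeCount_eq {n : ℕ} {x : (⊤ : SimpleGraph (Fin n)).edgeSet → Bool}
    (h : edgeCount x = n.choose 2) : x = fun _ => true := by
  have huniv : (univ.filter fun e : (⊤ : SimpleGraph (Fin n)).edgeSet => x e = true) = univ := by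
    refine Finset.eq_univ_of_card _ ?_
    rw [card_edgeSet_top_fin n]
    exact h
  funext e
  have he := Finset.mem_univ e
  rw [← huniv, Finset.mem_filter] at he
  exact he.2

/-- The empty graph has no `k`-clique for `k ≥ 2`: `CLIQUE_k(∅) = 0`. [folklore] -/
theorem cliqueFn_false {n k : ℕ} (hk : 2 ≤ k) :
    cliqueFn n k (fun _ : (⊤ : SimpleGraph (Fin n)).edgeSet => false) = false := by
  rw [cliqueFn_eq_false_iff]
  have h : cliqueGraph (fun _ : (⊤ : SimpleGraph (Fin n)).edgeSet => false) = ⊥ := by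
    ext u v
    simp [cliqueGraph_adj]
  rw [h]
  exact SimpleGraph.cliqueFree_bot hk

/-- The complete graph `K_n` has a `k`-clique for `k ≤ n`: `CLIQUE_k(K_n) = 1`. [folklore] -/
theorem cliqueFn_true {n k : ℕ} (hk : k ≤ n) :
    cliqueFn n k (fun _ : (⊤ : SimpleGraph (Fin n)).edgeSet => true) = true := by
  have h : (fun _ : (⊤ : SimpleGraph (Fin n)).edgeSet => true) = cliqueVec (univ : Finset (Fin n)) := by
    funext e
    simp [cliqueVec]
  rw [h]
  exact cliqueFn_cliqueVec (by simpa using hk)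

/-- For `n ≥ 2` the complete graph `K_n` has an edge (the input variable used by the size-0
witnesses). [folklore] -/
theorem exists_edge {n : ℕ} (hn : 2 ≤ n) : Nonempty ((⊤ : SimpleGraph (Fin n)).edgeSet) := by
  refine ⟨⟨s(⟨0, by omega⟩, ⟨1, by omega⟩), ?_⟩⟩
  rw [SimpleGraph.mem_edgeSet, SimpleGraph.top_adj]
  simp [Fin.ext_iff]

/-- The gate-free circuit `x_e`: size `0`, `acDepth 0`, over every basis. [folklore] -/
theorem input_facts {ι : Type*} (i : ι) (B : Set GateFn) :
    (Circuit.input i).IsOver B ∧ (Circuit.input i).acDepth = 0 ∧ (Circuit.input i).size = 0 ∧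
      ∀ x, (Circuit.input i).eval x = x i :=
  ⟨fun g hg => by simp [Circuit.input] at hg, rfl, rfl, fun _ => rfl⟩

/-- **One gate of fan-in `|ι|` with an arbitrary truth table `f`**: a circuit (over `fullBasis`,
in general NOT over `acBasis`) of size `1` and `acDepth ≤ 1` computing `f` exactly. With
`f = cliqueFn n k` this is the witness that the basis restriction is load-bearing. [folklore] -/
theorem exists_oneGate_circuit (ι : Type*) [Fintype ι] [DecidableEq ι] (f : (ι → Bool) → Bool) :
    ∃ C : Circuit ι, C.size = 1 ∧ C.acDepth ≤ 1 ∧ ∀ x, C.eval x = f x := by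
  let C : Circuit ι :=
    { gates := [⟨Fintype.card ι, fun v => f fun i => v (Fintype.equivFin ι i),
        fun a => .inl ((Fintype.equivFin ι).symm a)⟩]
      output := .inr 0
      wf := fun j h a m hm => by
        simp only [List.length_singleton, Nat.lt_one_iff] at h
        subst h
        simp at hm
      wf_output := fun m h => by cases h; simp }
  refine ⟨C, rfl, ?_, ?_⟩
  · simp only [Circuit.acDepth, Circuit.depthWith, Circuit.depthVals, C, List.foldl_cons,
      List.foldl_nil, List.nil_append, List.getD_cons_zero]
    refine Nat.add_le_of_le_sub' (by unfold acWeight; split <;> simp) ?_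
    exact (Finset.sup_le fun a _ => le_rfl).trans (Nat.zero_le _)
  · intro x
    have h : C.eval x = f (fun i => x ((Fintype.equivFin ι).symm (Fintype.equivFin ι i))) := rfl
    rw [h]
    simp

/-- `m_k(n) ≤ C(n,2)` for `k ≥ 2` (the threshold density is at most `1`). [folklore] -/
theorem mk_le_choose {n k : ℕ} (hn : 1 ≤ n) (hk : 2 ≤ k) : mk n k ≤ n.choose 2 := by
  refine Nat.floor_le_of_le ?_
  have hn1 : (1 : ℝ) ≤ n := by exact_mod_cast hn
  have hk1 : (1 : ℝ) < k := by exact_mod_cast hk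
  have hexp : -(2 : ℝ) / ((k : ℝ) - 1) ≤ 0 :=
    div_nonpos_of_nonpos_of_nonneg (by norm_num) (by linarith)
  have hpow : (n : ℝ) ^ (-(2 : ℝ) / ((k : ℝ) - 1)) ≤ 1 :=
    Real.rpow_le_one_of_one_le_of_nonpos hn1 hexp
  calc ((n.choose 2 : ℕ) : ℝ) * (n : ℝ) ^ (-(2 : ℝ) / ((k : ℝ) - 1))
      ≤ ((n.choose 2 : ℕ) : ℝ) * 1 := mul_le_mul_of_nonneg_left hpow (Nat.cast_nonneg _)
    _ = _ := mul_one _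

/-- The density `q = m_k(n)/C(n,2)` is in `[0,1]` and at the centre of the window
(`n ≥ 2`, `k ≥ 2`). [folklore] -/
theorem centre_density {n k : ℕ} (hn : 2 ≤ n) (hk : 2 ≤ k) :
    0 ≤ (mk n k : ℝ) / (n.choose 2 : ℕ) ∧ (mk n k : ℝ) / (n.choose 2 : ℕ) ≤ 1 ∧
      |(mk n k : ℝ) / (n.choose 2 : ℕ) * (n.choose 2 : ℕ) - (mk n k : ℝ)| ≤
        (mk n k : ℝ) ^ ((3 : ℝ) / 4) := by
  have hN : (0 : ℝ) < (n.choose 2 : ℕ) := by exact_mod_cast Nat.choose_pos hn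
  refine ⟨div_nonneg (Nat.cast_nonneg _) hN.le, ?_, ?_⟩
  · rw [div_le_one hN]
    exact_mod_cast mk_le_choose (by omega) hk
  · rw [div_mul_cancel₀ _ hN.ne', sub_self, abs_zero]
    exact Real.rpow_nonneg (Nat.cast_nonneg _) _

/-- The central edge count `j = m_k(n)` is in the window. [folklore] -/
theorem centre_count (n k : ℕ) :
    |((mk n k : ℕ) : ℝ) - (mk n k : ℝ)| ≤ (mk n k : ℝ) ^ ((3 : ℝ) / 4) := by
  rw [sub_self, abs_zero]
  exact Real.rpow_nonneg (Nat.cast_nonneg _) _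

/-- An exact circuit has slice error `0`. [folklore] -/
theorem sliceErr_eq_zero_of_forall {n : ℕ} (j : ℕ)
    {f g : ((⊤ : SimpleGraph (Fin n)).edgeSet → Bool) → Bool} (h : ∀ x, f x = g x) :
    sliceErr n j f g = 0 := by
  rw [sliceErr, Finset.card_eq_zero, Finset.filter_eq_empty_iff]
  rintro x - ⟨-, hne⟩
  exact hne (h x)

/-- A circuit that computes `g` exactly has `G(n,q)`-error `0` against `g`. [folklore] -/
theorem gnpDisagreeProb_eq_zero_of_forall {n : ℕ} (q : ℝ)
    {f g : ((⊤ : SimpleGraph (Fin n)).edgeSet → Bool) → Bool} (h : ∀ x, f x = g x) :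
    gnpDisagreeProb n q f g = 0 := by
  rw [gnpDisagreeProb]
  refine Finset.sum_eq_zero fun x hx => ?_
  rw [Finset.mem_filter] at hx
  exact absurd (h x) hx.2

/-! ### Load-bearing clauses of the conclusion -/

/-- **The window is load-bearing** — for EVERY `d, c`, `k ≥ 2`, `δ ≥ 0`: without centrality the
clause fails at the slice `j = 0` (the empty graph), where the gate-free circuit `x_e` (size `0`,
depth `0`) agrees with `CLIQUE_k = 0`; `n ^ c < 0` is false. Any proof of the crux must use
`|j − m_k(n)| ≤ m_k(n)^{3/4}` at least to exclude `j = 0`. [folklore] -/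
theorem not_innerConcNoWindow (d c : ℕ) {k : ℕ} (hk : 2 ≤ k) {δ : ℝ} (hδ : 0 ≤ δ) :
    ¬ (∀ᶠ n : ℕ in atTop, ∀ j : ℕ,
        ∀ C : Circuit ((⊤ : SimpleGraph (Fin n)).edgeSet), C.IsOver acBasis → C.acDepth ≤ d →
          (sliceErr n j C.eval (cliqueFn n k) : ℝ) ≤ δ * sliceCard n j → n ^ c < C.size) := by
  intro h
  obtain ⟨n, hn, hn2⟩ := (h.and (eventually_ge_atTop 2)).exists
  obtain ⟨e⟩ := exists_edge hn2
  obtain ⟨hB, hD, hS, hE⟩ := input_facts e acBasis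
  have h0 : sliceErr n 0 (Circuit.input e).eval (cliqueFn n k) = 0 := by
    rw [sliceErr, Finset.card_eq_zero, Finset.filter_eq_empty_iff]
    rintro x - ⟨hx0, hne⟩
    have hx := eq_false_of_edgeCount_eq_zero hx0
    subst hx
    exact hne (by rw [hE, cliqueFn_false hk])
  have herr : (sliceErr n 0 (Circuit.input e).eval (cliqueFn n k) : ℝ) ≤ δ * sliceCard n 0 := by
    rw [h0, Nat.cast_zero]
    exact mul_nonneg hδ (Nat.cast_nonneg _)
  have := hn 0 (Circuit.input e) hB (hD.trans_le (Nat.zero_le d)) herr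
  rw [hS] at this
  exact Nat.not_lt_zero _ this

/-- **The window needs an upper cutoff** — for every `d ≥ 1`, `c`, `k ≥ 2`, `δ ≥ 0`: with only
`m_k(n) ≤ j` the clause fails at the top slice `j = C(n,2)` (the complete graph, `CLIQUE_k = 1` once
`n ≥ k`), where the one-gate constant circuit `∧₀ = true` (size `1`, `acDepth 1`) is exact;
`n ^ c < 1` is false. The honest open question — how WIDE the window may be (e.g. `[m, m·n^ε]`
should already fail via `Pr_j[no k-clique] → 0`, a second-moment computation on the slice) — is not
attempted. [folklore] -/
theorem not_innerConcWindowAbove {d : ℕ} (hd : 1 ≤ d) (c : ℕ) {k : ℕ} (hk : 2 ≤ k) {δ : ℝ}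
    (hδ : 0 ≤ δ) : ¬ (∀ᶠ n : ℕ in atTop, ∀ j : ℕ, mk n k ≤ j →
        ∀ C : Circuit ((⊤ : SimpleGraph (Fin n)).edgeSet), C.IsOver acBasis → C.acDepth ≤ d →
          (sliceErr n j C.eval (cliqueFn n k) : ℝ) ≤ δ * sliceCard n j → n ^ c < C.size) := by
  intro h
  obtain ⟨n, hn, hnk⟩ := (h.and (eventually_ge_atTop (max k 1))).exists
  have hkn : k ≤ n := (le_max_left k 1).trans hnk
  have hn1 : 1 ≤ n := (le_max_right k 1).trans hnk
  have h0 : sliceErr n (n.choose 2) (Circuit.const _ true).eval (cliqueFn n k) = 0 := by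
    rw [sliceErr, Finset.card_eq_zero, Finset.filter_eq_empty_iff]
    rintro x - ⟨hx0, hne⟩
    have hx := eq_true_of_edgeCount_eq hx0
    subst hx
    exact hne (by rw [Circuit.eval_const, cliqueFn_true hkn])
  have herr : (sliceErr n (n.choose 2) (Circuit.const _ true).eval (cliqueFn n k) : ℝ) ≤
      δ * sliceCard n (n.choose 2) := by
    rw [h0, Nat.cast_zero]
    exact mul_nonneg hδ (Nat.cast_nonneg _)
  have hlt := hn (n.choose 2) (mk_le_choose hn1 hk) (Circuit.const _ true)
    (Circuit.const_isOver_acBasis true) (by rw [Circuit.acDepth_const]; exact hd) herr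
  rw [Circuit.size_const] at hlt
  exact absurd (Nat.one_le_pow c n hn1) (not_le.2 hlt)

/-- **The basis restriction is load-bearing** — for every `d ≥ 1`, `c`, `k`, `δ ≥ 0`: a single gate
of fan-in `C(n,2)` whose truth table is `CLIQUE_k` has size `1`, `acDepth 1` and error `0` on every
slice, in particular on the central slice `j = m_k(n)`; `n ^ c < 1` is false. (So the crux is
genuinely about the weakness of `{¬, ∧ₖ, ∨ₖ}`-gates, not about depth alone.) [folklore] -/
theorem not_innerConcNoBasis {d : ℕ} (hd : 1 ≤ d) (c k : ℕ) {δ : ℝ} (hδ : 0 ≤ δ) :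
    ¬ (∀ᶠ n : ℕ in atTop, ∀ j : ℕ, |(j : ℝ) - (mk n k : ℝ)| ≤ (mk n k : ℝ) ^ ((3 : ℝ) / 4) →
        ∀ C : Circuit ((⊤ : SimpleGraph (Fin n)).edgeSet), C.acDepth ≤ d →
          (sliceErr n j C.eval (cliqueFn n k) : ℝ) ≤ δ * sliceCard n j → n ^ c < C.size) := by
  intro h
  obtain ⟨n, hn, hn1⟩ := (h.and (eventually_ge_atTop 1)).exists
  obtain ⟨C, hS, hD, hE⟩ :=
    exists_oneGate_circuit ((⊤ : SimpleGraph (Fin n)).edgeSet) (cliqueFn n k)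
  have herr : (sliceErr n (mk n k) C.eval (cliqueFn n k) : ℝ) ≤ δ * sliceCard n (mk n k) := by
    rw [sliceErr_eq_zero_of_forall _ hE, Nat.cast_zero]
    exact mul_nonneg hδ (Nat.cast_nonneg _)
  have hlt := hn (mk n k) (centre_count n k) C (hD.trans hd) herr
  rw [hS] at hlt
  exact absurd (Nat.one_le_pow c n hn1) (not_le.2 hlt)

/-- **The accuracy hypothesis is load-bearing** (trivially; all `d, c, k`): the gate-free circuit
`x_e` has size `0`. Recorded only to complete the census of clauses. [folklore] -/
theorem not_innerConcNoError (d c k : ℕ) : ¬ (∀ᶠ n : ℕ in atTop, ∀ j : ℕ, |(j : ℝ) - (mk n k : ℝ)| ≤ (mk n k : ℝ) ^ ((3 : ℝ) / 4) →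
        ∀ C : Circuit ((⊤ : SimpleGraph (Fin n)).edgeSet), C.IsOver acBasis → C.acDepth ≤ d →
          n ^ c < C.size) := by
  intro h
  obtain ⟨n, hn, hn2⟩ := (h.and (eventually_ge_atTop 2)).exists
  obtain ⟨e⟩ := exists_edge hn2
  obtain ⟨hB, hD, hS, -⟩ := input_facts e acBasis
  have := hn (mk n k) (centre_count n k) (Circuit.input e) hB (hD.trans_le (Nat.zero_le d))
  rw [hS] at this
  exact Nat.not_lt_zero _ this

end Summit.PneNP.PneNP.Theorems.SliceACZero.Negative

end
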